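import Summits.NavierStokesRegularity.FluidComputer.BlockAmplitudeCeiling
import Summits.NavierStokesRegularity.FluidComputer.OccupationFloorsHold
import HarnessLib

/-!
# Fluid computer — L15: the FRONT'S RESIDENCE IS PAID IN TAIL ENSTROPHY-TIME (amplitude × spectral-tail floor)

HONEST FRAMING (cell `pub-fluidc`, verbatim): *low prior, high value-of-information experiment on Tao's
machine paradigm; NOT a claim that NS blows up.* Theorem side of the cell (necessities every cascade design must
respect); nothing here is evidence of blow-up, and nothing is said about any fixed finite set of levels.

The occupation / residence floors (`OccupationFloorsHold.restart_residence_floor_window`, Cheskidov–Dai 2015 Thm 1.1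
discharged in the tree): along every maximal smooth finite-energy solution with lifespan `T`, inside every terminal
window `(t₀, T)`, at infinitely many levels `q` the Cheskidov–Shvydkoy front `Λ_c(u(t))` (top saturated level,
`‖Δ̇_j u‖_∞ ≥ c ν 2^j`) DWELLS at or above level `q` for a time `R_q` with `2^q U_q R_q > c`
(`U_q = sup_{(t₀,T)} ‖Δ̇_q u‖_∞`). The a-priori side of the same dictionary (Cheskidov–Shvydkoy 2014, Lemma 4.1; tree
`exists_two_pow_mul_volume_setOf_saturated_le`) prices the level sets of the front by the TOTAL dissipation,
`(cν)² 2^q |{Λ ≥ 2^q}| ≤ C E(u₀)/ν`. This file localises that price to the SPECTRAL TAIL and the WINDOW, using only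
Bernstein at the saturated level (`BlockAmplitudeCeiling.exists_blockSup_le_blockL2`) and Markov's inequality in time
(block energies are continuous in time, `BlockEnergyContinuity`):

* `volume_saturated_le` — per level: `(bν)² 2^p · |{τ ∈ (s,t) : level p saturated}| ≤ C_B² 4^p ∫⁻_{(s,t)} ‖Δ̇_p u‖₂²`
  (a saturated level holds at least the one-eddy energy `(bν)² 2^{-p}/C_B²`; Markov);
* `volume_front_le_tsum` — `|{τ ∈ (s,t) : Λ_b(u τ) ≥ 2^q}| ≤ ∑_{p ≥ q} |{τ ∈ (s,t) : level p saturated}|` (`q ≥ 1`;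
  the definition of `Λ`);
* `front_residence_le_tail` (**L15 — RESIDENCE COSTS TAIL ENSTROPHY-TIME**) — for every window `(s,t) ⊆ (0,T)` and
  `q ≥ 1`: `(bν)² · 2^q · |{τ ∈ (s,t) : Λ_b(u τ) ≥ 2^q}| ≤ C_B² · ∑_{p ≥ q} 4^p ∫⁻_{(s,t)} ‖Δ̇_p u(τ)‖₂² dτ` — the time
  the front spends at or above level `q` is paid by the ENSTROPHY-TIME CARRIED ABOVE LEVEL `q` IN THAT WINDOW (not merely
  by the total dissipation budget `E₀/ν`);
* `amplitude_tail_floor` (**L15′ — THE AMPLITUDE × SPECTRAL-TAIL FLOOR**) — composing with the residence floor: there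
  are absolute `c > 0` and `C_B` with, for every maximal smooth solution Leray–Hopf from `u 0` and every `t₀ < T`, at
  INFINITELY MANY levels `q`: `c³ ν² < C_B² · U_q · ∑_{p ≥ q} 4^p ∫⁻_{(t₀,T)} ‖Δ̇_p u‖₂²`. Cascade reading: the window
  sup-amplitude of a level and the enstrophy-time the solution carries above that level in the same window cannot
  BOTH be small — a blow-up with a thin spectral tail over the terminal window needs proportionally HUGE amplitudes at
  the front (`U_q ≥ c³ν² / (C_B² Tail_q)`, with `Tail_q → 0` as `q → ∞` whenever the window's enstrophy-time is finite),
  and a blow-up with moderate front amplitudes needs a FAT tail. Both factors are instruments of the atlas (band sups,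
  band energies integrated in time). Necessity only; nothing about sufficiency.

0 sorry; no new definitions, no named facts (inputs: `exists_blockSup_le_blockL2`,
`BlockEnergyContinuity.continuousOn_blockL2_sq`, `two_pow_le_dissipationWavenumber_iff`,
`OccupationFloorsHold.restart_residence_floor_window` — all proved in the tree).

## References

* A. Cheskidov, R. Shvydkoy, *A unified approach to regularity problems for the 3D Navier–Stokes and Euler equations:
  the use of Kolmogorov's dissipation range*, J. Math. Fluid Mech. 16 (2014) 263–273, §3, Lemma 4.1.
  [CheskidovShvydkoy2011]
* A. Cheskidov, M. Dai, *Regularity criteria for the 3D Navier–Stokes and MHD equations*, arXiv:1507.06611 =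
  Proc. Edinburgh Math. Soc. (2025), Thm. 1.1. [CheskidovDai2015]
* H. Bahouri, J.-Y. Chemin, R. Danchin, *Fourier Analysis and Nonlinear PDE*, Springer 2011, Lemma 2.1 (Bernstein).
  [BahouriCheminDanchin2011]
-/

noncomputable section

open MeasureTheory Set Function Filter Topology TemperedDistribution
open scoped ENNReal NNReal SchwartzMap
open Literature.Analysis.FluidPDE Literature.Analysis.FunctionSpaces
open Summit.NavierStokesRegularity.FluidComputer.BlockAmplitudeCeiling

namespace Summit.NavierStokesRegularity.FluidComputer.FrontResidenceCost

/-! ## Per level: saturated time is paid in block energy-time -/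

/-- Squaring Bernstein at a saturated level: if `b ν 2^p ≤ ‖Δ̇_p v‖_∞ ≤ C 2^{3p/2} ‖Δ̇_p v‖₂` then
`(bν)² 2^p ≤ C² 4^p ‖Δ̇_p v‖₂²`. [cite: BahouriCheminDanchin2011, Lemma 2.1] -/
theorem sq_mul_two_pow_le_of_saturated {v : EuclideanSpace ℝ (Fin 3) → EuclideanSpace ℝ (Fin 3)} {b ν : ℝ} {p : ℕ}
    {C : ℝ≥0} (hbern : blockSup v p ≤ C * (2 : ℝ≥0∞) ^ (3 * ((p : ℤ) : ℝ) / 2) * blockL2 v p)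
    (hsat : IsSaturatedLevel b ν v p) :
    ENNReal.ofReal (b * ν) ^ 2 * (2 : ℝ≥0∞) ^ p ≤ (C : ℝ≥0∞) ^ 2 * (2 : ℝ≥0∞) ^ (2 * p) * blockL2 v p ^ 2 := by
  have h1 : ENNReal.ofReal (b * ν) * (2 : ℝ≥0∞) ^ p ≤ C * (2 : ℝ≥0∞) ^ (3 * ((p : ℤ) : ℝ) / 2) * blockL2 v p :=
    hsat.trans hbern
  have h2 := mul_le_mul' h1 h1
  have hpow : (2 : ℝ≥0∞) ^ (3 * ((p : ℤ) : ℝ) / 2) * (2 : ℝ≥0∞) ^ (3 * ((p : ℤ) : ℝ) / 2) =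
      (2 : ℝ≥0∞) ^ (3 * p) := by
    rw [two_rpow_mul_two_rpow, show 3 * ((p : ℤ) : ℝ) / 2 + 3 * ((p : ℤ) : ℝ) / 2 = ((3 * p : ℕ) : ℝ) by
      push_cast; ring, ENNReal.rpow_natCast]
  have h3 : ENNReal.ofReal (b * ν) ^ 2 * (2 : ℝ≥0∞) ^ p * (2 : ℝ≥0∞) ^ p ≤
      (C : ℝ≥0∞) ^ 2 * (2 : ℝ≥0∞) ^ (2 * p) * blockL2 v p ^ 2 * (2 : ℝ≥0∞) ^ p := by
    calc ENNReal.ofReal (b * ν) ^ 2 * (2 : ℝ≥0∞) ^ p * (2 : ℝ≥0∞) ^ p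
        = (ENNReal.ofReal (b * ν) * (2 : ℝ≥0∞) ^ p) * (ENNReal.ofReal (b * ν) * (2 : ℝ≥0∞) ^ p) := by ring
      _ ≤ (C * (2 : ℝ≥0∞) ^ (3 * ((p : ℤ) : ℝ) / 2) * blockL2 v p) *
            (C * (2 : ℝ≥0∞) ^ (3 * ((p : ℤ) : ℝ) / 2) * blockL2 v p) := h2
      _ = (C : ℝ≥0∞) ^ 2 * ((2 : ℝ≥0∞) ^ (3 * ((p : ℤ) : ℝ) / 2) * (2 : ℝ≥0∞) ^ (3 * ((p : ℤ) : ℝ) / 2)) *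
            blockL2 v p ^ 2 := by ring
      _ = (C : ℝ≥0∞) ^ 2 * (2 : ℝ≥0∞) ^ (2 * p) * blockL2 v p ^ 2 * (2 : ℝ≥0∞) ^ p := by
            rw [hpow]; ring
  exact (ENNReal.mul_le_mul_iff_left (pow_ne_zero _ two_ne_zero) (ENNReal.pow_ne_top ENNReal.ofNat_ne_top)).1 h3

/-- **Saturated time is paid in block energy-time (per level).** With the Bernstein constant `C_B` of
`BlockAmplitudeCeiling.exists_blockSup_le_blockL2`: for every maximal smooth solution `(u, p)` of the unforced
Navier–Stokes system on `ℝ³ × [0, T)` (`ν > 0`) which is Leray–Hopf from `u 0`, every window `(s, t)` with `0 ≤ s`,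
`t ≤ T`, every threshold `b` and every level `p`:
`(bν)² · 2^p · |{τ ∈ (s,t) : ‖Δ̇_p u(τ)‖_∞ ≥ b ν 2^p}| ≤ C_B² · 4^p · ∫⁻_{(s,t)} ‖Δ̇_p u(τ)‖₂² dτ` — a saturated level holds at
least the energy `(bν)² 2^{-p}/C_B²` of one eddy at the floor velocity, and Markov's inequality in time (block energies
are continuous on `(0,T)`, `BlockEnergyContinuity.continuousOn_blockL2_sq`) converts held energy into energy-time.
[cite: CheskidovShvydkoy2011, Lemma 4.1 (proof)] -/
theorem volume_saturated_le :
    ∃ C : ℝ≥0, C ≠ 0 ∧ ∀ (ν T : ℝ), 0 < ν → 0 < T →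
      ∀ (u : ℝ → EuclideanSpace ℝ (Fin 3) → EuclideanSpace ℝ (Fin 3)) (p : ℝ → EuclideanSpace ℝ (Fin 3) → ℝ),
      IsMaximalSmoothSolution ν 0 u p T → IsLerayHopfOn T ν 0 (u 0) u →
      ∀ s t : ℝ, 0 ≤ s → t ≤ T → ∀ (b : ℝ) (q : ℕ),
        ENNReal.ofReal (b * ν) ^ 2 * (2 : ℝ≥0∞) ^ q * volume {τ ∈ Ioo s t | IsSaturatedLevel b ν (u τ) q} ≤
          (C : ℝ≥0∞) ^ 2 * (2 : ℝ≥0∞) ^ (2 * q) * ∫⁻ τ in Ioo s t, blockL2 (u τ) q ^ 2 := by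
  obtain ⟨C, hC, hB⟩ := exists_blockSup_le_blockL2
  refine ⟨C, hC, fun ν T hν hT u p hmax hLH s t hs htT b q => ?_⟩
  set μ : Measure ℝ := volume.restrict (Ioo s t) with hμ
  set E : ℝ≥0∞ := ENNReal.ofReal (b * ν) ^ 2 * (2 : ℝ≥0∞) ^ q with hE
  set f : ℝ → ℝ≥0∞ := fun τ => (C : ℝ≥0∞) ^ 2 * (2 : ℝ≥0∞) ^ (2 * q) * blockL2 (u τ) q ^ 2 with hf
  have hsub : Ioo s t ⊆ Ioo 0 T := fun τ hτ => ⟨hs.trans_lt hτ.1, hτ.2.trans_le htT⟩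
  -- a.e.-measurability of the block energy in time on the window
  have hfm : AEMeasurable f μ := by
    refine AEMeasurable.const_mul ?_ _
    exact ((BlockEnergyContinuity.continuousOn_blockL2_sq hν hT hmax hLH (q : ℤ)).mono hsub).aemeasurable
      measurableSet_Ioo
  -- the saturated set lies in the Chebyshev set `{E ≤ f}`
  have hincl : {τ ∈ Ioo s t | IsSaturatedLevel b ν (u τ) q} ⊆ Ioo s t ∩ {τ | E ≤ f τ} := by
    intro τ hτ
    refine ⟨hτ.1, ?_⟩
    have hmem : MemLp (u τ) 2 volume := hLH.memLp τ ⟨(hsub hτ.1).1.le, (hsub hτ.1).2.le⟩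
    exact sq_mul_two_pow_le_of_saturated (hB (u τ) hmem q) hτ.2
  have hmarkov : E * μ {τ | E ≤ f τ} ≤ ∫⁻ τ, f τ ∂μ := mul_meas_ge_le_lintegral₀ hfm E
  calc E * volume {τ ∈ Ioo s t | IsSaturatedLevel b ν (u τ) q}
      ≤ E * volume (Ioo s t ∩ {τ | E ≤ f τ}) := by gcongr
    _ = E * μ {τ | E ≤ f τ} := by rw [hμ, Measure.restrict_apply' measurableSet_Ioo, inter_comm]
    _ ≤ ∫⁻ τ, f τ ∂μ := hmarkov
    _ = (C : ℝ≥0∞) ^ 2 * (2 : ℝ≥0∞) ^ (2 * q) * ∫⁻ τ in Ioo s t, blockL2 (u τ) q ^ 2 :=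
        lintegral_const_mul' _ _ (ENNReal.mul_ne_top (ENNReal.pow_ne_top ENNReal.coe_ne_top)
          (ENNReal.pow_ne_top ENNReal.ofNat_ne_top))

/-! ## The front's residence and the tail -/

/-- **The front at or above level `q ≥ 1` means some level `p ≥ q` is saturated**: for any family of slices,
`|{τ ∈ (s,t) : 2^q ≤ Λ_b(u τ)}| ≤ ∑_{n} |{τ ∈ (s,t) : level q+n saturated}|` (definition of the dissipation wavenumber,
`two_pow_le_dissipationWavenumber_iff`, and countable subadditivity). [cite: CheskidovShvydkoy2011, §3 (definition of Λ)] -/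
theorem volume_front_le_tsum (b ν : ℝ) (u : ℝ → EuclideanSpace ℝ (Fin 3) → EuclideanSpace ℝ (Fin 3))
    (s t : ℝ) {q : ℕ} (hq : 1 ≤ q) :
    volume (Ioo s t ∩ {τ | (2 : ℝ≥0∞) ^ q ≤ dissipationWavenumber b ν (u τ)}) ≤
      ∑' n : ℕ, volume {τ ∈ Ioo s t | IsSaturatedLevel b ν (u τ) (q + n)} := by
  have hsub : Ioo s t ∩ {τ | (2 : ℝ≥0∞) ^ q ≤ dissipationWavenumber b ν (u τ)} ⊆
      ⋃ n : ℕ, {τ ∈ Ioo s t | IsSaturatedLevel b ν (u τ) (q + n)} := by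
    rintro τ ⟨hτ, hΛ⟩
    rcases (two_pow_le_dissipationWavenumber_iff b ν (u τ) q).1 hΛ with h0 | ⟨j, hqj, hj⟩
    · omega
    · obtain ⟨n, rfl⟩ := Nat.exists_eq_add_of_le hqj
      exact mem_iUnion.2 ⟨n, hτ, hj⟩
  exact (measure_mono hsub).trans (measure_iUnion_le _)

/-- **L15 — THE FRONT'S RESIDENCE IS PAID IN TAIL ENSTROPHY-TIME.** With the Bernstein constant `C_B`: for every maximal
smooth solution `(u, p)` of the unforced Navier–Stokes system on `ℝ³ × [0, T)` (`ν > 0`) which is Leray–Hopf from `u 0`,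
every window `(s, t)` with `0 ≤ s`, `t ≤ T`, every threshold `b` and every level `q ≥ 1`:
`(bν)² · 2^q · |{τ ∈ (s,t) : Λ_b(u(τ)) ≥ 2^q}| ≤ C_B² · ∑_{p ≥ q} 4^p ∫⁻_{(s,t)} ‖Δ̇_p u(τ)‖₂² dτ` — the RESIDENCE TIME
of the Cheskidov–Shvydkoy front at or above level `q` inside the window is bounded by the ENSTROPHY-TIME THE SOLUTION
CARRIES ABOVE LEVEL `q` IN THAT WINDOW, divided by `(bν)² 2^q` (the tail- and window-local form of Lemma 4.1's
`(cν)² 2^q |{Λ ≥ 2^q}| ≲ E(u₀)/ν`). [cite: CheskidovShvydkoy2011, Lemma 4.1] -/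
theorem front_residence_le_tail :
    ∃ C : ℝ≥0, C ≠ 0 ∧ ∀ (ν T : ℝ), 0 < ν → 0 < T →
      ∀ (u : ℝ → EuclideanSpace ℝ (Fin 3) → EuclideanSpace ℝ (Fin 3)) (p : ℝ → EuclideanSpace ℝ (Fin 3) → ℝ),
      IsMaximalSmoothSolution ν 0 u p T → IsLerayHopfOn T ν 0 (u 0) u →
      ∀ s t : ℝ, 0 ≤ s → t ≤ T → ∀ (b : ℝ) (q : ℕ), 1 ≤ q →
        ENNReal.ofReal (b * ν) ^ 2 * (2 : ℝ≥0∞) ^ q *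
            volume (Ioo s t ∩ {τ | (2 : ℝ≥0∞) ^ q ≤ dissipationWavenumber b ν (u τ)}) ≤
          (C : ℝ≥0∞) ^ 2 * ∑' n : ℕ, (2 : ℝ≥0∞) ^ (2 * (q + n)) * ∫⁻ τ in Ioo s t, blockL2 (u τ) (q + n : ℕ) ^ 2 := by
  obtain ⟨C, hC, H⟩ := volume_saturated_le
  refine ⟨C, hC, fun ν T hν hT u p hmax hLH s t hs htT b q hq => ?_⟩
  calc ENNReal.ofReal (b * ν) ^ 2 * (2 : ℝ≥0∞) ^ q *
        volume (Ioo s t ∩ {τ | (2 : ℝ≥0∞) ^ q ≤ dissipationWavenumber b ν (u τ)})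
      ≤ ENNReal.ofReal (b * ν) ^ 2 * (2 : ℝ≥0∞) ^ q *
          ∑' n : ℕ, volume {τ ∈ Ioo s t | IsSaturatedLevel b ν (u τ) (q + n)} := by
        gcongr; exact volume_front_le_tsum b ν u s t hq
    _ = ∑' n : ℕ, ENNReal.ofReal (b * ν) ^ 2 * (2 : ℝ≥0∞) ^ q *
          volume {τ ∈ Ioo s t | IsSaturatedLevel b ν (u τ) (q + n)} := by rw [ENNReal.tsum_mul_left]
    _ ≤ ∑' n : ℕ, (C : ℝ≥0∞) ^ 2 * ((2 : ℝ≥0∞) ^ (2 * (q + n)) *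
          ∫⁻ τ in Ioo s t, blockL2 (u τ) (q + n : ℕ) ^ 2) := by
        refine ENNReal.tsum_le_tsum fun n => ?_
        calc ENNReal.ofReal (b * ν) ^ 2 * (2 : ℝ≥0∞) ^ q *
              volume {τ ∈ Ioo s t | IsSaturatedLevel b ν (u τ) (q + n)}
            ≤ ENNReal.ofReal (b * ν) ^ 2 * (2 : ℝ≥0∞) ^ (q + n) *
                volume {τ ∈ Ioo s t | IsSaturatedLevel b ν (u τ) (q + n)} := by
              gcongr
              · exact one_le_two
              · exact Nat.le_add_right q n
          _ ≤ (C : ℝ≥0∞) ^ 2 * (2 : ℝ≥0∞) ^ (2 * (q + n)) * ∫⁻ τ in Ioo s t, blockL2 (u τ) (q + n : ℕ) ^ 2 :=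
              H ν T hν hT u p hmax hLH s t hs htT b (q + n)
          _ = _ := by ring
    _ = (C : ℝ≥0∞) ^ 2 * ∑' n : ℕ, (2 : ℝ≥0∞) ^ (2 * (q + n)) *
          ∫⁻ τ in Ioo s t, blockL2 (u τ) (q + n : ℕ) ^ 2 := by rw [ENNReal.tsum_mul_left]

/-! ## L15′ — the amplitude × spectral-tail floor -/

/-- **L15′ — THE AMPLITUDE × SPECTRAL-TAIL FLOOR OF A BLOW-UP.** There are an absolute `c > 0` (the Cheskidov–Dai
occupation constant of `OccupationFloorsHold.restart_residence_floor_window`) and the Bernstein constant `C_B ≠ 0` such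
that for every `ν > 0`, `T > 0`, every maximal smooth solution `(u, p)` of the unforced Navier–Stokes system on
`ℝ³ × [0, T)` which is Leray–Hopf from `u 0` (finite energy, finite lifespan `T`), and every `t₀ ∈ [0, T)`: at
INFINITELY MANY levels `q`,
`c³ ν² < C_B² · U_q · Tail_q`, `U_q = sup_{τ ∈ (t₀,T)} ‖Δ̇_q u(τ)‖_∞`, `Tail_q = ∑_{p ≥ q} 4^p ∫⁻_{(t₀,T)} ‖Δ̇_p u(τ)‖₂² dτ`.
Proof: the residence floor `c < 2^q U_q R_q` (front dwells at or above `q` for `R_q`, infinitely often) times `(cν)²`,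
and L15 `(cν)² 2^q R_q ≤ C_B² Tail_q`. Cascade reading: in every terminal window the window SUP-AMPLITUDE of a level and
the ENSTROPHY-TIME carried above it cannot both be small, infinitely often up the ladder — the front amplitudes must
diverge at least like `c³ν²/(C_B² Tail_q)`, the inverse of the spectral tail's enstrophy-time, and conversely a blow-up
whose front amplitudes stay moderate must keep a fat enstrophy tail in the window. Both factors are atlas instruments
(band sups; time-integrated band energies). Necessity only; nothing about sufficiency or about any fixed finite set of
levels. [cite: CheskidovDai2015, §1 Thm. 1.1] -/
theorem amplitude_tail_floor :
    ∃ (c : ℝ) (C : ℝ≥0), 0 < c ∧ C ≠ 0 ∧ ∀ (ν T : ℝ), 0 < ν → 0 < T →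
      ∀ (u : ℝ → EuclideanSpace ℝ (Fin 3) → EuclideanSpace ℝ (Fin 3)) (p : ℝ → EuclideanSpace ℝ (Fin 3) → ℝ),
      IsMaximalSmoothSolution ν 0 u p T → IsLerayHopfOn T ν 0 (u 0) u →
      ∀ t₀ ∈ Ico 0 T, ∃ᶠ q : ℕ in atTop,
        ENNReal.ofReal (c ^ 3 * ν ^ 2) <
          (C : ℝ≥0∞) ^ 2 * (⨆ τ ∈ Ioo t₀ T, blockSup (u τ) q) *
            ∑' n : ℕ, (2 : ℝ≥0∞) ^ (2 * (q + n)) * ∫⁻ τ in Ioo t₀ T, blockL2 (u τ) (q + n : ℕ) ^ 2 := by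
  obtain ⟨c, hc, Hres⟩ := OccupationFloorsHold.restart_residence_floor_window
  obtain ⟨C, hC, Htail⟩ := front_residence_le_tail
  refine ⟨c, C, hc, hC, fun ν T hν hT u p hmax hLH t₀ ht₀ => ?_⟩
  have hk0 : ENNReal.ofReal (c * ν) ^ 2 ≠ 0 :=
    pow_ne_zero _ (by rw [Ne, ENNReal.ofReal_eq_zero, not_le]; exact mul_pos hc hν)
  have hktop : ENNReal.ofReal (c * ν) ^ 2 ≠ ∞ := ENNReal.pow_ne_top ENNReal.ofReal_ne_top
  refine ((Hres ν T hν hT u p hmax hLH t₀ ht₀).and_eventually (eventually_ge_atTop 1)).mono ?_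
  rintro q ⟨hq, hq1⟩
  set U := ⨆ τ ∈ Ioo t₀ T, eLpNorm (blockFn (q : ℤ) (u τ)) ∞ volume with hU
  set R := volume (Ioo t₀ T ∩ {τ | (2 : ℝ≥0∞) ^ q ≤ dissipationWavenumber c ν (u τ)}) with hR
  set Tail := ∑' n : ℕ, (2 : ℝ≥0∞) ^ (2 * (q + n)) * ∫⁻ τ in Ioo t₀ T, blockL2 (u τ) (q + n : ℕ) ^ 2 with hTail
  have htail := Htail ν T hν hT u p hmax hLH t₀ T ht₀.1 le_rfl c q hq1
  have hprod : ENNReal.ofReal (c ^ 3 * ν ^ 2) = ENNReal.ofReal c * ENNReal.ofReal (c * ν) ^ 2 := by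
    rw [← ENNReal.ofReal_pow (mul_pos hc hν).le, ← ENNReal.ofReal_mul hc.le]
    congr 1; ring
  calc ENNReal.ofReal (c ^ 3 * ν ^ 2) = ENNReal.ofReal c * ENNReal.ofReal (c * ν) ^ 2 := hprod
    _ < (2 : ℝ≥0∞) ^ q * U * R * ENNReal.ofReal (c * ν) ^ 2 := ENNReal.mul_lt_mul_left hk0 hktop hq
    _ = U * (ENNReal.ofReal (c * ν) ^ 2 * (2 : ℝ≥0∞) ^ q * R) := by ring
    _ ≤ U * ((C : ℝ≥0∞) ^ 2 * Tail) := by gcongr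
    _ = (C : ℝ≥0∞) ^ 2 * U * Tail := by ring

end Summit.NavierStokesRegularity.FluidComputer.FrontResidenceCost

end
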